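import Literature.AlgebraicGeometry.Morphisms.SteinOfArtinianBase
import Literature.AlgebraicGeometry.AbelianSchemes.AbelianSchemeSteinOfReduced
import Mathlib.AlgebraicGeometry.Noetherian
import HarnessLib

/-!
# An abelian scheme over an Artin local base is Stein: `Γ(W, 𝒪_S) → Γ(p⁻¹W, 𝒪_A)` is bijective

For an abelian scheme `p : A → S = Spec R` over an ARTIN LOCAL ring `R`, the comorphism
`p^♯_W : Γ(W, 𝒪_S) → Γ(p⁻¹W, 𝒪_A)` is bijective for every open `W ⊆ S` (`app_bijective_of_isArtinianRing`), in
particular `Γ(A, 𝒪_A) = R` (`W = ⊤`; for a general reduced-or-not base the global-sections form is ★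
`RigidifiedAutOfReducedBase.appTop_hom_bijective` / (u7-iii)); and the `hStein` binder shape of
★ `AbelianSchemes/RigidifiedGluing.rigidifiedGluing_of_stein` at Artin-local test schemes:
`baseChange_app_bijective_of_isArtinianRing` — for `A → S` abelian over ANY base and `f : Spec R → S` with `R`
Artin local, `Γ(W, 𝒪) → Γ(pr⁻¹W, 𝒪_{A ×_S Spec R})` is bijective. These are the three shapes of
★ `AbelianSchemes/AbelianSchemeSteinOfReduced` (reduced locally Noetherian bases) at Artin local bases — the
second piece (u7-ii) of the (U)-lane brick (u7) «universal Stein `𝒪_T ⥲ (p_T)_*𝒪_{A_T}` for abelian schemes»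
(Görtz–Wedhorn II, Cor. 24.63; EGA III 7.8.6) of cell `hodgecm-mathlib`; consumer: (u7-iii)/(iv) Noetherian-local and
general bases (B-p17, `Morphisms/SteinOfFormalLevels`, `SteinOfArtinLevels`).

Proof: ★ `Morphisms/SteinOfArtinianBase.appTop_bijective_of_isArtinianRing` (flat + quasi-compact + separated +
Stein special fibre ⇒ Stein over the Artin local base, by the Čech/dévissage argument — no `H¹`), whose special-fibre
input is ★ `app_bijective_of_isReduced` for the abelian scheme `A ×_R Spec k` over the REDUCED base `Spec k`; an Artin
local spectrum has exactly one point, so `W ∈ {⊥, ⊤}`.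

## References

* U. Görtz, T. Wedhorn, *Algebraic Geometry II: Cohomology of Schemes* (2023), Cor. 24.63 (p. 404), Exercise 23.43
  (p. 374). [GortzWedhorn2023]
* D. Mumford, J. Fogarty, F. Kirwan, *Geometric Invariant Theory*, 3rd ed. (1994), Ch. 6 §1, Prop. 6.1 (pp. 115–116).
  [MumfordFogartyKirwan1994]
* A. Grothendieck, EGA III₂ (1963), (7.8.6). [EGAIII2]
-/

noncomputable section

universe u

open CategoryTheory CategoryTheory.Limits AlgebraicGeometry TopologicalSpace Opposite

namespace Literature.AlgebraicGeometry.AbelianSchemes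

namespace AbelianSchemeOver

variable {R : Type u} [CommRing R] [IsArtinianRing R] [IsLocalRing R] (A : AbelianSchemeOver (Spec (.of R)))

omit [IsArtinianRing R] [IsLocalRing R] in
/-- The opens of the spectrum of a ring with exactly one prime ideal are `⊥` and `⊤`. [folklore] -/
private theorem opens_eq_bot_or_top [Subsingleton (PrimeSpectrum R)] (W : (Spec (CommRingCat.of R)).Opens) :
    W = ⊥ ∨ W = ⊤ := by
  by_cases h : ∃ x, x ∈ W
  · obtain ⟨x, hx⟩ := h
    refine Or.inr (top_le_iff.mp fun y _ => ?_)
    have : y = x := Subsingleton.elim (α := PrimeSpectrum R) y x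
    rw [this]; exact hx
  · refine Or.inl (le_bot_iff.mp fun y hy => h ⟨y, hy⟩)

/-- An Artin local ring has exactly one prime ideal. [folklore] -/
private theorem subsingleton_primeSpectrum : Subsingleton (PrimeSpectrum R) :=
  ⟨fun p q => PrimeSpectrum.ext ((IsLocalRing.eq_maximalIdeal (inferInstance : p.asIdeal.IsMaximal)).trans
    (IsLocalRing.eq_maximalIdeal (inferInstance : q.asIdeal.IsMaximal)).symm)⟩

/-- **An abelian scheme over an Artin local base is Stein**: for `p : A → Spec R` abelian with `R` Artin local,
`p^♯_W : Γ(W, 𝒪) → Γ(p⁻¹W, 𝒪_A)` is bijective for every open `W`. For `W = ⊤` (`Γ(A, 𝒪_A) = R`): `A → Spec R` is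
flat (smooth), quasi-compact and separated (proper), and its special fibre `A ×_R Spec k` is an abelian scheme over the
REDUCED base `Spec k`, hence Stein by ★ `app_bijective_of_isReduced`; conclude by the Čech/dévissage theorem
★ `Morphisms.appTop_bijective_of_isArtinianRing`. For `W = ⊥` both sides are the zero ring (an Artin local spectrum
has one point, so these are all the opens). [cite: GortzWedhorn2023, Cor. 24.63 (p. 404)]
[cite: MumfordFogartyKirwan1994, Ch. 6 §1 Proposition 6.1 (pp. 115–116), hypothesis] -/
theorem app_bijective_of_isArtinianRing (W : (Spec (CommRingCat.of R)).Opens) : Function.Bijective (A.X.hom.app W) := by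
  haveI := subsingleton_primeSpectrum (R := R)
  rcases opens_eq_bot_or_top W with rfl | rfl
  · -- `W = ⊥`: source and target are terminal rings
    haveI : Subsingleton Γ(Spec (CommRingCat.of R), (⊥ : (Spec (CommRingCat.of R)).Opens)) :=
      CommRingCat.subsingleton_of_isTerminal ((Spec (CommRingCat.of R)).sheaf.isTerminalOfEqEmpty rfl)
    haveI : Subsingleton Γ(A.X.left, A.X.hom ⁻¹ᵁ (⊥ : (Spec (CommRingCat.of R)).Opens)) :=
      CommRingCat.subsingleton_of_isTerminal (A.X.left.sheaf.isTerminalOfEqEmpty (by simp))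
    exact ⟨fun a b _ => Subsingleton.elim a b, fun y => ⟨0, Subsingleton.elim _ _⟩⟩
  · -- `W = ⊤`
    haveI := A.isSmooth
    haveI := A.isProper
    let s : Spec (.of (IsLocalRing.ResidueField R)) ⟶ Spec (.of R) :=
      Spec.map (CommRingCat.ofHom (algebraMap R (IsLocalRing.ResidueField R)))
    have hk : Function.Bijective (pullback.snd A.X.hom s).appTop := (A.baseChange s).app_bijective_of_isReduced ⊤
    exact Morphisms.appTop_bijective_of_isArtinianRing A.X.hom hk

/-- **`A_T → T` is Stein for `T = Spec R`, `R` Artin local** — the binder `hStein` of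
`RigidifiedGluing.rigidifiedGluing_of_stein` at Artin-local test schemes: for an abelian scheme `A → S` over ANY base,
`f : Spec R → S` with `R` Artin local and every open `W ⊆ Spec R`, `Γ(W, 𝒪) → Γ(pr⁻¹W, 𝒪_{A ×_S Spec R})` is bijective.
(The input of the Noetherian-local step (u7-iii) at the levels `Spec (B ⧸ 𝔪ⁿ) → S`.)
[cite: GortzWedhorn2023, Cor. 24.63 (p. 404)] -/
theorem baseChange_app_bijective_of_isArtinianRing {S : Scheme.{u}} (B : AbelianSchemeOver S)
    (f : Spec (CommRingCat.of R) ⟶ S) (W : (Spec (CommRingCat.of R)).Opens) :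
    Function.Bijective ((B.baseChange f).X.hom.app W) :=
  (B.baseChange f).app_bijective_of_isArtinianRing W

/-- Global-sections form of the base change: `Γ(Spec R, 𝒪) → Γ(A ×_S Spec R, 𝒪)` is bijective for `R` Artin local.
[cite: GortzWedhorn2023, Cor. 24.63 (p. 404)] -/
theorem baseChange_appTop_bijective_of_isArtinianRing {S : Scheme.{u}} (B : AbelianSchemeOver S)
    (f : Spec (CommRingCat.of R) ⟶ S) : Function.Bijective (B.baseChange f).X.hom.appTop :=
  (B.baseChange f).app_bijective_of_isArtinianRing ⊤

/-- The same in the `algebraMapΓ` currency of ★ `Morphisms/FormalFunctions`: `R → Γ(A ×_S Spec R, 𝒪)`,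
`r ↦ pr₂^♯(r)`, is bijective for `R` Artin local. [cite: GortzWedhorn2023, Cor. 24.63 (p. 404)] -/
theorem bijective_algebraMapΓ_baseChange_of_isArtinianRing {S : Scheme.{u}} (B : AbelianSchemeOver S)
    (f : Spec (CommRingCat.of R) ⟶ S) :
    Function.Bijective (Morphisms.algebraMapΓ (pullback.snd B.X.hom f)) :=
  (Morphisms.bijective_algebraMapΓ_iff_bijective_appTop _).2 (B.baseChange_appTop_bijective_of_isArtinianRing f)

omit [IsArtinianRing R] [IsLocalRing R] A in
/-- **All Artin-local base changes of an abelian scheme are Stein** — the hypothesis `hArt` of the Noetherian-local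
step (u7-iii) (`Morphisms/SteinOfArtinLevels.app_bijective_snd_of_artinLevels`, B-p17) VERBATIM: for every Artin
local `R′` and `i : Spec R′ → S`, `R′ → Γ(A ×_S Spec R′, 𝒪)` is bijective. [cite: GortzWedhorn2023, Cor. 24.63 (p. 404)] -/
theorem artinLevels_bijective_algebraMapΓ {S : Scheme.{u}} (B : AbelianSchemeOver S) :
    ∀ (R' : Type u) [CommRing R'] [IsArtinianRing R'] [IsLocalRing R'] (i : Spec (.of R') ⟶ S),
      Function.Bijective (Morphisms.algebraMapΓ (pullback.snd B.X.hom i)) :=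
  fun _ _ _ _ i => B.bijective_algebraMapΓ_baseChange_of_isArtinianRing i

end AbelianSchemeOver

end Literature.AlgebraicGeometry.AbelianSchemes

end
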